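import Summits.CriticalPhenomena.Ising3DConformalLimit.Theorems.EnergyNotSigmaSquaredGapForcesFarMergingSandwichDefs
import Summits.CriticalPhenomena.Ising3DConformalLimit.Theorems.IsingEuclidUpgradeR4NonGaussianDefs
import Literature.Probability.LatticeModels.SourcedDoubleCurrentsOneArmMoments
import Literature.Probability.LatticeModels.SourcedDoubleCurrentsProofs
import HarnessLib

/-!
# Tail tightness of the one-pinch duplicated avoidance: the first-moment (union) bound
# (line `one-cluster-depletion-sandwich` of crux `GapForcesFarMerging`, item stmt-CriticalPhenomena-4468;
# helper file 1/2 for the registered stub `stub_tailTightness`)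

For the four-trace law `fourTraceLaw n y = P^{y₀y₁,∅}_{Λ_n} ⊗ P^{y₂y₃,∅}_{Λ_n}` of the Defs module
(two INDEPENDENT duplicated clusters `C₁ = C_{n₁+n₂}(y₀)`, `C₂ = C_{n₃+n₄}(y₂)` in the free box
`Λ_n ⊂ ℤ³` at `β_c`), the avoidance inside the ball `Λ_R` exceeds the total avoidance by at most the
expected number of common vertices of the two clusters outside `Λ_R`:

  `avoidIn n R y - avoid n y ≤ P[∃ v ∉ Λ_R, v ∈ C₁ ∩ C₂] ≤ ∑_{v ∈ Λ_n ∖ Λ_R} ρ_n(y₀,y₁;v) ρ_n(y₂,y₃;v)`,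

with the EXACT one-point density of a sourced duplicated cluster (switching lemma, ADC21 App. A
Prop. A.3 first display; tree `Current.tsum_epairWeight_mul_indicator_mem_cluster`)
`ρ_n(a,b;v) = P^{ab,∅}_{Λ_n}[v ∈ C_{n₁+n₂}(a)] = G_n(a,v)G_n(v,b)/G_n(a,b)` = `threePointRatio n a b v`
(vocabulary `boxG`, `threePointRatio` of the landed `IsingEuclidUpgradeR4NonGaussianDefs`).
Ingredients: (i) vertices of a duplicated cluster other than its root lie in `Λ_n`, so the law gives
mass `0` to `{v ∈ C(a)}` for `v ∉ Λ_n`; (ii) the one-point density read through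
`sourcedDoubleCurrentLaw_apply` / `sourcedTrace_preimage_openConn` and the box dictionary
`G_n = Z[·]/Z[∅]` (`SourcedDoubleCurrentsOneArmMoments`); (iii) the union bound and `Measure.prod_prod`.
Everything is proved; no definition and no named fact is introduced. The registered helper is the
last theorem `tailTightness_firstMomentTail`.

References: M. Aizenman, H. Duminil-Copin, Ann. of Math. 194 (2021) = arXiv:1912.07973, §3.1–3.2,
§4.2 (proof of Lemma 4.4, first moment of `|𝓜|`), App. A Prop. A.3 [AizenmanDuminilCopinAnnals2021].
-/

noncomputable section

namespace Summit.CriticalPhenomena.Ising3DConformalLimit.EnergyNotSigmaSquaredGapForcesFarMergingSandwich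

namespace TailTightnessProof

open scoped symmDiff ENNReal Topology
open MeasureTheory Filter
open Literature.Probability.LatticeModels Literature.Probability.Percolation
open Summit.CriticalPhenomena.Ising3DConformalLimit.GapForcesFarMergingSandwich
open Summit.CriticalPhenomena.Ising3DConformalLimit.Cruxes.IsingEuclidUpgradeR4NonGaussian.FreeCovarianceDeltaDichotomy
  (boxG threePointRatio)

/-! ## §1. Support: a duplicated cluster of the box lives in `Λ_n` -/

/-- A vertex of the cluster of `a` in the trace of a current of the free box graph, other than `a`
itself, lies in `Λ_n`: it is an endpoint of a traced bond, and bonds of the free box graph have both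
endpoints in `Λ_n`. [folklore] -/
theorem mem_box_of_mem_cluster {n : ℕ} {m : Current (freeBoxGraph 3 n)} {a v : BoxVertex 3 n}
    (hv : v ∈ m.cluster a) (hva : v ≠ a) : (v : Site 3) ∈ box 3 n := by
  rw [Current.mem_cluster_iff] at hv
  obtain ⟨w⟩ := hv.symm
  cases w with
  | nil => exact absurd rfl hva
  | cons hadj _ =>
    rw [openGraph_adj] at hadj
    exact ((freeBoxGraph_adj 3 _ _).1 (Current.traced_subset_edgeSet m hadj.1)).2.1

/-- The sourced box law `P^{ab,∅}_{Λ_n}` gives mass `0` to `{v ∈ C(a)}` when `a ∈ Λ_n` and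
`v ∉ Λ_n` (the lifted trace connects `a` only to vertices of `Λ_n`). [folklore] -/
theorem law_openConn_eq_zero {n : ℕ} {a v : Site 3} (b : Site 3) (ha : a ∈ box 3 n)
    (hv : v ∉ box 3 n) :
    sourcedDoubleCurrentLaw 3 n βc ({a} ∆ {b}) ∅ (openConn a v) = 0 := by
  have ha1 : a ∈ box 3 (n + 1) := box_subset_box_succ 3 n ha
  have hpre : sourcedTrace 3 n ⁻¹' (openConn a v : Set (BondConfig (Site 3))) = ∅ := by
    ext p
    simp only [Set.mem_preimage, Set.mem_empty_iff_false, iff_false]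
    intro hp
    obtain ⟨hv1, hreach⟩ := reachable_of_reachable_liftBonds 3 hp ha1
    have hva : (⟨v, hv1⟩ : BoxVertex 3 n) ≠ ⟨a, ha1⟩ := fun h => hv (by
      have h' : v = a := congrArg Subtype.val h
      rw [h']; exact ha)
    exact hv (mem_box_of_mem_cluster (Current.mem_cluster_iff.2 hreach) hva)
  rw [sourcedDoubleCurrentLaw_apply _ _ _ _ (measurableSet_openConn_holds a v), hpre, measure_empty]

/-! ## §2. The exact one-point density of a sourced duplicated cluster in the box -/

/-- `#({a} ∆ {b})` is even (it is `0` or `2`). [folklore] -/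
theorem even_card_pair_symmDiff (a b : Site 3) : Even (({a} ∆ {b} : Finset (Site 3))).card := by
  by_cases hab : a = b
  · rw [hab, symmDiff_self, Finset.bot_eq_empty, Finset.card_empty]
    exact Even.zero
  · have h : ({a} ∆ {b} : Finset (Site 3)) = {a, b} := by
      rw [Disjoint.symmDiff_eq_sup (Finset.disjoint_singleton.2 hab), Finset.sup_eq_union,
        Finset.insert_eq]
    rw [h, Finset.card_pair hab]
    exact even_two

/-- For `a, b ∈ Λ_n` the sourced box law `P^{ab,∅}_{Λ_n,β_c}` is a probability measure
(`β_c(3) > 0`, `Z_{Λ_n}[ab] > 0`). [folklore] -/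
theorem isProbabilityMeasure_law {n : ℕ} {a b : Site 3} (ha : a ∈ box 3 n) (hb : b ∈ box 3 n) :
    IsProbabilityMeasure (sourcedDoubleCurrentLaw 3 n βc ({a} ∆ {b}) ∅) := by
  -- adapted from `floorsRed_isProbabilityMeasure` (EnergyNotSigmaSquaredGapForcesFarMergingFloorsReduction)
  have hβ : 0 < βc := criticalBeta_pos_holds (d := 3) (by norm_num)
  have hsub : ({a} ∆ {b} : Finset (Site 3)) ⊆ box 3 n := fun v hv => by
    rcases Finset.mem_symmDiff.1 hv with ⟨h, -⟩ | ⟨h, -⟩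
    · rw [Finset.mem_singleton.1 h]; exact ha
    · rw [Finset.mem_singleton.1 h]; exact hb
  exact isProbabilityMeasure_sourcedDoubleCurrentLaw hβ.le
    (currentSum_boxSources_pos 3 hβ hsub (even_card_pair_symmDiff a b)).ne'
    (currentSum_boxSources_pos 3 hβ (Finset.empty_subset _) (by simp)).ne'

/-- The four-trace law of a quadruple inside `Λ_n` is a probability measure. [folklore] -/
theorem isProbabilityMeasure_fourTraceLaw {n : ℕ} {y : Fin 4 → Site 3} (hy : ∀ i, y i ∈ box 3 n) :
    IsProbabilityMeasure (fourTraceLaw n y) := by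
  haveI := isProbabilityMeasure_law (hy 0) (hy 1)
  haveI := isProbabilityMeasure_law (hy 2) (hy 3)
  unfold fourTraceLaw
  infer_instance

/-- **The exact one-point density** (switching lemma; Aizenman–Duminil-Copin 2021, App. A Prop. A.3,
first display, in the free box): for `a, b, v ∈ Λ_n`,
`P^{ab,∅}_{Λ_n,β_c}[v ∈ C_{n₁+n₂}(a)] = G_n(a,v) G_n(v,b) / G_n(a,b)`.
[cite: AizenmanDuminilCopinAnnals2021, Appendix A, Proposition A.3 (first display)] -/
theorem law_real_openConn_eq {n : ℕ} {a b v : Site 3} (ha : a ∈ box 3 n) (hb : b ∈ box 3 n)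
    (hv : v ∈ box 3 n) :
    (sourcedDoubleCurrentLaw 3 n βc ({a} ∆ {b}) ∅).real (openConn a v) = threePointRatio n a b v := by
  have hl : ∀ x ∈ box 3 n, ∃ x' : BoxVertex 3 n, (x' : Site 3) = x := fun x hx =>
    ⟨⟨x, box_subset_box_succ 3 n hx⟩, rfl⟩
  obtain ⟨⟨a, rfl⟩, ⟨b, rfl⟩, ⟨v, rfl⟩⟩ := And.intro (hl a ha) (And.intro (hl b hb) (hl v hv))
  have hβ : 0 ≤ βc := criticalBeta_nonneg 3
  set K : (freeBoxGraph 3 n).edgeFinset → ℝ := fun _ => βc with hKdef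
  have hK : ∀ e, 0 ≤ K e := fun _ => hβ
  have hG : ∀ x z : BoxVertex 3 n, (x : Site 3) ∈ box 3 n → (z : Site 3) ∈ box 3 n →
      boxG n x z = (ecurrentSum K ({x} ∆ {z})).toReal / (ecurrentSum K ∅).toReal :=
    fun x z hx hz => isingTwoPoint_free_box_eq_toReal_div n hβ x z hx hz
  have hZtop : ∀ S, ecurrentSum K S ≠ ∞ := fun S => ecurrentSum_ne_top hK S
  have hr0 : 0 < (ecurrentSum K ∅).toReal := ENNReal.toReal_pos (ecurrentSum_empty_ne_zero K) (hZtop _)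
  -- nondegeneracy `G_n(a,b) ≠ 0` (`Z_{Λ_n}[ab] > 0` since `β_c > 0`)
  have hβpos : 0 < βc := criticalBeta_pos_holds (d := 3) (by norm_num)
  have hsub : ({(a : Site 3)} ∆ {(b : Site 3)} : Finset (Site 3)) ⊆ box 3 n := fun w hw => by
    rcases Finset.mem_symmDiff.1 hw with ⟨h, -⟩ | ⟨h, -⟩
    · rw [Finset.mem_singleton.1 h]; exact ha
    · rw [Finset.mem_singleton.1 h]; exact hb
  have hcsab : currentSum (freeBoxGraph 3 n) βc ({a} ∆ {b}) ≠ 0 := by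
    have h := (currentSum_boxSources_pos 3 hβpos hsub (even_card_pair_symmDiff _ _)).ne'
    rwa [boxSources_pair] at h
  have hcs0 : currentSum (freeBoxGraph 3 n) βc ∅ ≠ 0 := by
    have h := (currentSum_boxSources_pos 3 hβpos (Finset.empty_subset (box 3 n)) (by simp)).ne'
    rwa [boxSources_empty] at h
  have hZab : ecurrentSum K ({a} ∆ {b}) ≠ 0 := fun h => hcsab (by
    rw [currentSum_eq_wcurrentSum, ← toReal_ecurrentSum hK, h, ENNReal.toReal_zero])
  have hrab : 0 < (ecurrentSum K ({a} ∆ {b})).toReal := ENNReal.toReal_pos hZab (hZtop _)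
  have hab : boxG n a b ≠ 0 := by rw [hG a b ha hb]; exact (div_pos hrab hr0).ne'
  -- the event, read on pairs of currents
  rw [measureReal_def, sourcedDoubleCurrentLaw_apply _ _ _ _ (measurableSet_openConn_holds _ _),
    boxSources_pair, boxSources_empty, sourcedTrace_preimage_openConn, ← measureReal_def,
    doubleCurrentMeasure_real_eq_toReal_div n a b hβ hcsab hcs0]
  -- the numerator: `∑ W 𝟙[v ∈ C(a)] = Z[bv] Z[av]`
  have hnum : ∑' p, epairWeight K ({a} ∆ {b}) ∅ p *
      (tracedConn (freeBoxGraph 3 n) a v).indicator 1 p =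
      ecurrentSum K ({b} ∆ {v}) * ecurrentSum K ({a} ∆ {v}) := by
    rw [← Current.tsum_epairWeight_mul_indicator_mem_cluster hK a b v]
    refine tsum_congr fun p => ?_
    congr 1
    by_cases h : v ∈ (p.1 + p.2).cluster a
    · rw [if_pos h, Set.indicator_of_mem ((mem_tracedConn_iff _ a v p).2 (Current.mem_cluster_iff.1 h)),
        Pi.one_apply]
    · rw [if_neg h, Set.indicator_of_notMem fun h' =>
        h (Current.mem_cluster_iff.2 ((mem_tracedConn_iff _ a v p).1 h'))]
  have h1 := toReal_sum_currentSum_pair_mul n a b (boxG n) hβ ha hb hG hab {v} (by simpa using hv)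
  rw [Finset.sum_singleton, Finset.sum_singleton] at h1
  rw [← hKdef, hnum, h1, mul_div_assoc, div_self (mul_pos hrab hr0).ne', mul_one]
  rfl

/-! ## §3. The union bound: avoidance inside `Λ_R` versus total avoidance -/

/-- **First-moment tail bound** (union bound over the common vertex outside `Λ_R`, independence,
and the exact one-point densities): for a quadruple `y` inside `Λ_n`,
`avoidIn n R y - avoid n y ≤ ∑_{v ∈ Λ_n ∖ Λ_R} ρ_n(y₀,y₁;v) ρ_n(y₂,y₃;v)`.
[cite: AizenmanDuminilCopinAnnals2021, §4.2, proof of Lemma 4.4 (first moment of |𝓜|)] -/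
theorem avoidIn_sub_avoid_le {n R : ℕ} {y : Fin 4 → Site 3} (hy : ∀ i, y i ∈ box 3 n) :
    avoidIn n R y - avoid n y ≤
      ∑ v ∈ box 3 n \ box 3 R, threePointRatio n (y 0) (y 1) v * threePointRatio n (y 2) (y 3) v := by
  haveI := isProbabilityMeasure_law (hy 0) (hy 1)
  haveI := isProbabilityMeasure_law (hy 2) (hy 3)
  haveI : IsProbabilityMeasure (fourTraceLaw n y) := isProbabilityMeasure_fourTraceLaw hy
  set μ := fourTraceLaw n y with hμdef
  have hμ : μ = (sourcedDoubleCurrentLaw 3 n βc ({y 0} ∆ {y 1}) ∅).prod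
      (sourcedDoubleCurrentLaw 3 n βc ({y 2} ∆ {y 3}) ∅) := rfl
  -- the rectangles `{v ∈ C₁} × {v ∈ C₂}`
  set F : Site 3 → Set (BondConfig (Site 3) × BondConfig (Site 3)) :=
    fun v => (openConn (y 0) v : Set (BondConfig (Site 3))) ×ˢ (openConn (y 2) v : Set (BondConfig (Site 3)))
    with hFdef
  have hsub : (MeetIn R y)ᶜ ⊆ (Meet y)ᶜ ∪
      ((⋃ v ∈ box 3 n \ box 3 R, F v) ∪ ⋃ v ∈ ((box 3 n : Set (Site 3))ᶜ), F v) := by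
    intro ω hω
    by_cases hM : ω ∈ Meet y
    · obtain ⟨u, hu1, hu2⟩ := hM
      have huR : u ∉ box 3 R := fun h => hω ⟨u, h, hu1, hu2⟩
      refine Or.inr ?_
      by_cases hun : u ∈ box 3 n
      · exact Or.inl (Set.mem_iUnion₂.2 ⟨u, Finset.mem_sdiff.2 ⟨hun, huR⟩, Set.mk_mem_prod hu1 hu2⟩)
      · exact Or.inr (Set.mem_iUnion₂.2 ⟨u, hun, Set.mk_mem_prod hu1 hu2⟩)
    · exact Or.inl hM
  have hF : ∀ v, μ.real (F v) = (sourcedDoubleCurrentLaw 3 n βc ({y 0} ∆ {y 1}) ∅).real (openConn (y 0) v) *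
      (sourcedDoubleCurrentLaw 3 n βc ({y 2} ∆ {y 3}) ∅).real (openConn (y 2) v) := fun v => by
    rw [measureReal_def, hμ, hFdef, Measure.prod_prod, ENNReal.toReal_mul, measureReal_def, measureReal_def]
  have hnull : μ.real (⋃ v ∈ ((box 3 n : Set (Site 3))ᶜ), F v) = 0 := by
    rw [measureReal_def, (measure_biUnion_null_iff (Set.to_countable _)).2 fun v hv => ?_,
      ENNReal.toReal_zero]
    rw [hμ, hFdef, Measure.prod_prod, law_openConn_eq_zero (y 1) (hy 0) hv, zero_mul]
  have hfin : μ.real (⋃ v ∈ box 3 n \ box 3 R, F v) ≤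
      ∑ v ∈ box 3 n \ box 3 R, threePointRatio n (y 0) (y 1) v * threePointRatio n (y 2) (y 3) v := by
    refine (measureReal_biUnion_finset_le _ F).trans (le_of_eq (Finset.sum_congr rfl fun v hv => ?_))
    have hvn : v ∈ box 3 n := (Finset.mem_sdiff.1 hv).1
    rw [hF v, law_real_openConn_eq (hy 0) (hy 1) hvn, law_real_openConn_eq (hy 2) (hy 3) hvn]
  have havoidIn : avoidIn n R y = μ.real (MeetIn R y)ᶜ := rfl
  have havoid : avoid n y = μ.real (Meet y)ᶜ := rfl
  rw [havoidIn, havoid]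
  have h1 := measureReal_mono (μ := μ) hsub (measure_ne_top _ _)
  have h2 := measureReal_union_le (μ := μ) (Meet y)ᶜ
    ((⋃ v ∈ box 3 n \ box 3 R, F v) ∪ ⋃ v ∈ ((box 3 n : Set (Site 3))ᶜ), F v)
  have h3 := measureReal_union_le (μ := μ) (⋃ v ∈ box 3 n \ box 3 R, F v)
    (⋃ v ∈ ((box 3 n : Set (Site 3))ᶜ), F v)
  linarith

end TailTightnessProof

open MeasureTheory Filter
open Literature.Probability.LatticeModels Literature.Probability.Percolation
open Summit.CriticalPhenomena.Ising3DConformalLimit.GapForcesFarMergingSandwich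
open Summit.CriticalPhenomena.Ising3DConformalLimit.Cruxes.IsingEuclidUpgradeR4NonGaussian.FreeCovarianceDeltaDichotomy
  (threePointRatio)

/-- **Registered helper `tailTightness_firstMomentTail`** (first-moment tail bound for the two
independent duplicated clusters of the line's four-trace law, helper for `stub_tailTightness`): for
every quadruple `y ⊂ Λ_n` and every radius `R`,
`avoidIn n R y - avoid n y ≤ ∑_{v ∈ Λ_n ∖ Λ_R} ρ_n(y₀,y₁;v) ρ_n(y₂,y₃;v)`,
`ρ_n(a,b;v) = G_n(a,v)G_n(v,b)/G_n(a,b)` the exact one-point density of a sourced duplicated cluster.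
[cite: AizenmanDuminilCopinAnnals2021, §4.2, proof of Lemma 4.4, and Appendix A, Proposition A.3] -/
theorem tailTightness_firstMomentTail : ∀ (n R : ℕ) (y : Fin 4 → Site 3), (∀ i, y i ∈ box 3 n) → avoidIn n R y - avoid n y ≤ ∑ v ∈ box 3 n \ box 3 R, threePointRatio n (y 0) (y 1) v * threePointRatio n (y 2) (y 3) v :=
  fun _ _ _ hy => TailTightnessProof.avoidIn_sub_avoid_le hy

end Summit.CriticalPhenomena.Ising3DConformalLimit.EnergyNotSigmaSquaredGapForcesFarMergingSandwich

end
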